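import Mathlib.Tactic.Ring
import Mathlib.Tactic.NormNum
import Summits.CriticalPhenomena.PercolationContinuityZ3.Theorems.PercNearOneGluingNoHeavyLowerTailSahiCTCGenFun
import HarnessLib

/-!
# `NoHeavyLowerTail` (crux stmt-CriticalPhenomena-4575), P3 lane: VERTEX-RELATIVE ATOMS for the step certificates of the threshold-certificate
# programme — the vertex split of a generating function, the g9 §7.1 statuses `l/m/o` and level classes, the 36 region atoms `α[a,b,L]`,
# status families and their atom expansion, and the dictionary writing the natural deletion/link families as status families

Support file (seat `prim-l12-p3`, gen 19; `--supports stmt-CriticalPhenomena-4575`).  Memo `run/shared/lean/prim/prim-l12/FROM-prim-l12-p3-g19-CERTIFICATE-ROAD-G011.md`;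
memo g9 (`…-g9-COEFFICIENTWISE-THRESHOLD-CERTIFICATE.md`) §7 for the inductive certificate framework.  Nothing is asserted about the crux.

g9 §7: a 4-row form `F(K_X,K_Z)` on the ground set `V` expands at a vertex `v` as `Σ_j r_v^j N_j` where every object (`Π`, `Θ₁`, `D₁`, `h_X`, `t_X`, …)
splits as (deletion part) `+ r_v·`(link part) (`gf_powerset_filter_split`), and every such part is the generating function of a family of subsets of
`V' = V − v` described by the `v`-relative X-status, Z-status and level class of its members only (`statFam`); it is therefore a sum of the ATOMS
`atom V' KX KZ v a b L = GF{S ⊆ V' : statuses (a,b), level L}` (`gf_statFam`).  The step certificates are identities in these atoms.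
* `stat K v S ∈ {0,1,2}` (`l`: `S ∪ {v} ∈ K`; `m`: `S ∈ K`, `S ∪ {v} ∉ K`; `o`: `S ∉ K`), `lvl S = min #S 3`; monotone for down-sets (`stat_mono`, `lvl_mono`);
* `atom`, `statFam`, `gf_statFam`; `atom_zero_eq` (the level-0 atoms record the statuses of `∅`, i.e. the liveness case), `atom_eq_zero_of_dead_X/Z`;
  `isLowerSet_statFam` (antitone conditions give down-sets), `statFam_inter`, `statFam_filter_card`;
The dictionary (natural deletion/link families as status families) is in `…SahiCTCVertexExpansions`.
-/

namespace Summit.CriticalPhenomena.PercolationContinuityZ3.Theorems.SahiCTCForms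

open Finset MvPolynomial SahiCTCGenFun SahiCTCWeightedLYM

variable {α : Type*} [DecidableEq α]

/-! ### Splitting a generating function at a vertex: `GF_V(F) = GF_{V−v}(del) + r_v · GF_{V−v}(link)` -/

omit [DecidableEq α] in
/-- `1_{S ∪ {v}} = 1_v + 1_S` for `v ∉ S`. [this work] -/
theorem ind_insert [DecidableEq α] {v : α} {S : Finset α} (hv : v ∉ S) : ind (insert v S) = Finsupp.single v 1 + ind S := by
  unfold ind; rw [sum_insert hv]

/-- `r^{S ∪ {v}} = r_v · r^S` for `v ∉ S`. [this work] -/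
theorem monomial_ind_insert {v : α} {S : Finset α} (hv : v ∉ S) :
    (monomial (ind (insert v S)) (1 : ℤ) : MvPolynomial α ℤ) = X v * monomial (ind S) 1 := by
  rw [ind_insert hv, show (X v : MvPolynomial α ℤ) = monomial (Finsupp.single v 1) 1 from rfl, monomial_mul, one_mul]

/-- **Vertex split of a generating function**: for `v ∈ V` and any predicate `p`,
`GF{S ⊆ V : p S} = GF{S ⊆ V−v : p S} + r_v · GF{S ⊆ V−v : p (S ∪ {v})}` (deletion + `r_v`·link). [this work] -/
theorem gf_powerset_filter_split {V : Finset α} {v : α} (hv : v ∈ V) (p : Finset α → Prop) [DecidablePred p] :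
    gf (V.powerset.filter p) =
      gf ((V.erase v).powerset.filter p) + X v * gf ((V.erase v).powerset.filter fun S => p (insert v S)) := by
  unfold gf
  rw [← sum_filter_add_sum_filter_not (V.powerset.filter p) (fun S => v ∉ S)]
  congr 1
  · refine sum_congr ?_ fun _ _ => rfl
    ext S
    simp only [mem_filter, mem_powerset, subset_erase]
    tauto
  · rw [mul_sum]
    have himg : (V.powerset.filter p).filter (fun S => ¬ v ∉ S) =
        ((V.erase v).powerset.filter fun S => p (insert v S)).image (insert v) := by
      ext S
      simp only [mem_filter, mem_image, mem_powerset, not_not]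
      constructor
      · rintro ⟨⟨hSV, hp⟩, hvS⟩
        refine ⟨S.erase v, ⟨?_, ?_⟩, insert_erase hvS⟩
        · exact erase_subset_erase v hSV
        · rw [insert_erase hvS]; exact hp
      · rintro ⟨T, ⟨hT, hp⟩, rfl⟩
        rw [subset_erase] at hT
        exact ⟨⟨insert_subset_iff.2 ⟨hv, hT.1⟩, hp⟩, mem_insert_self v T⟩
    rw [himg, sum_image]
    · refine sum_congr rfl fun T hT => ?_
      have hvT : v ∉ T := (subset_erase.1 (mem_powerset.1 (mem_filter.1 hT).1)).2
      rw [monomial_ind_insert hvT]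
    · intro T hT T' hT' h
      have hvT : v ∉ T := (subset_erase.1 (mem_powerset.1 (mem_filter.1 (mem_coe.1 hT)).1)).2
      have hvT' : v ∉ T' := (subset_erase.1 (mem_powerset.1 (mem_filter.1 (mem_coe.1 hT')).1)).2
      rw [← erase_insert hvT, h, erase_insert hvT']

/-- The unfiltered version: `Π_V = Π_{V−v} + r_v · Π_{V−v}`. [this work] -/
theorem gf_powerset_split {V : Finset α} {v : α} (hv : v ∈ V) :
    gf V.powerset = gf (V.erase v).powerset + X v * gf (V.erase v).powerset := by
  have h := gf_powerset_filter_split hv (fun _ => True)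
  simpa only [filter_true] using h

/-! ### Vertex-relative statuses (g9 §7.1: `l` = in the link, `m` = in the deletion only, `o` = outside) and level classes -/

/-- The `v`-relative status of a set `S` (with `v ∉ S`) in a family `K`: `0` (`l`) if `S ∪ {v} ∈ K`, `1` (`m`) if `S ∈ K` but `S ∪ {v} ∉ K`,
`2` (`o`) if `S ∉ K`. [this work] -/
def stat (K : Finset (Finset α)) (v : α) (S : Finset α) : ℕ := if insert v S ∈ K then 0 else if S ∈ K then 1 else 2

omit [DecidableEq α] in
/-- The level class of a set: `0` (empty), `1` (`B`, a point), `2` (`C`, a pair), `3` (`D`, size `≥ 3`). [this work] -/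
def lvl (S : Finset α) : ℕ := min #S 3

section statlemmas
variable {K : Finset (Finset α)} {v : α} {S T : Finset α}

/-- A status is at most `2`. [this work] -/
theorem stat_le_two : stat K v S ≤ 2 := by
  unfold stat; split_ifs <;> omega

/-- A status is `< 3`. [this work] -/
theorem stat_lt_three : stat K v S < 3 := Nat.lt_succ_of_le stat_le_two

/-- Status `0` (`l`) iff `S ∪ {v} ∈ K`. [this work] -/
theorem stat_eq_zero_iff : stat K v S = 0 ↔ insert v S ∈ K := by
  unfold stat; by_cases h1 : insert v S ∈ K <;> by_cases h2 : S ∈ K <;> simp [h1, h2]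

/-- For a down-set, status `≤ 1` iff `S ∈ K`. [this work] -/
theorem stat_le_one_iff (hK : IsLowerSet (K : Set (Finset α))) : stat K v S ≤ 1 ↔ S ∈ K := by
  unfold stat
  by_cases h1 : insert v S ∈ K
  · have h2 : S ∈ K := hK (subset_insert v S) h1
    simp [h1, h2]
  · by_cases h2 : S ∈ K <;> simp [h1, h2]

/-- Status `1` (`m`) iff `S ∈ K` and `S ∪ {v} ∉ K`. [this work] -/
theorem stat_eq_one_iff : stat K v S = 1 ↔ S ∈ K ∧ insert v S ∉ K := by
  unfold stat; by_cases h1 : insert v S ∈ K <;> by_cases h2 : S ∈ K <;> simp [h1, h2]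

/-- For a down-set, status `2` (`o`) iff `S ∉ K`. [this work] -/
theorem stat_eq_two_iff (hK : IsLowerSet (K : Set (Finset α))) : stat K v S = 2 ↔ S ∉ K := by
  rw [← stat_le_one_iff (v := v) hK, not_le]
  have h2 := stat_le_two (K := K) (v := v) (S := S)
  omega

/-- Statuses are monotone along inclusion for a down-set. [this work] -/
theorem stat_mono (hK : IsLowerSet (K : Set (Finset α))) (hST : S ⊆ T) : stat K v S ≤ stat K v T := by
  unfold stat
  by_cases hT1 : insert v T ∈ K
  · have hS1 : insert v S ∈ K := hK (insert_subset_insert v hST) hT1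
    simp [hT1, hS1]
  · by_cases hT2 : T ∈ K
    · have hS2 : S ∈ K := hK hST hT2
      by_cases hS1 : insert v S ∈ K <;> simp [hT1, hT2, hS1, hS2]
    · by_cases hS1 : insert v S ∈ K <;> by_cases hS2 : S ∈ K <;> simp [hT1, hT2, hS1, hS2]

/-- The status of the empty set: `0` iff `v` is live (`{v} ∈ K`), else `1` when `∅ ∈ K`. [this work] -/
theorem stat_empty_of_live (h : {v} ∈ K) : stat K v ∅ = 0 := by
  rw [stat_eq_zero_iff, insert_empty]; exact h

/-- The empty set has status `1` when `v` is dead and `∅ ∈ K`. [this work] -/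
theorem stat_empty_of_dead (h0 : ∅ ∈ K) (h : {v} ∉ K) : stat K v ∅ = 1 := by
  rw [stat_eq_one_iff, insert_empty]; exact ⟨h0, h⟩

/-- If `v` is dead in a down-set `K` (`{v} ∉ K`) then no set has status `0`. [this work] -/
theorem stat_ne_zero_of_dead (hK : IsLowerSet (K : Set (Finset α))) (h : {v} ∉ K) : stat K v S ≠ 0 := by
  rw [Ne, stat_eq_zero_iff]
  intro h1
  exact h (hK (by simp) h1)

end statlemmas

section lvllemmas
omit [DecidableEq α]
variable {S T : Finset α}

/-- A level class is at most `3`. [this work] -/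
theorem lvl_le_three : lvl S ≤ 3 := min_le_right _ _
/-- A level class is `< 4`. [this work] -/
theorem lvl_lt_four : lvl S < 4 := Nat.lt_succ_of_le lvl_le_three
/-- Level `0` iff the set is empty. [this work] -/
theorem lvl_eq_zero_iff : lvl S = 0 ↔ S = ∅ := by
  unfold lvl; rw [← card_eq_zero]; omega
/-- Level `≤ 1` iff `#S ≤ 1`. [this work] -/
theorem lvl_le_one_iff : lvl S ≤ 1 ↔ #S ≤ 1 := by unfold lvl; omega
/-- Level `≤ 2` iff `#S ≤ 2`. [this work] -/
theorem lvl_le_two_iff : lvl S ≤ 2 ↔ #S ≤ 2 := by unfold lvl; omega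
/-- Level `1` iff `#S = 1`. [this work] -/
theorem lvl_eq_one_iff : lvl S = 1 ↔ #S = 1 := by unfold lvl; omega
/-- Level `2` iff `#S = 2`. [this work] -/
theorem lvl_eq_two_iff : lvl S = 2 ↔ #S = 2 := by unfold lvl; omega
/-- Level `3` iff `3 ≤ #S`. [this work] -/
theorem lvl_eq_three_iff : lvl S = 3 ↔ 3 ≤ #S := by unfold lvl; omega
/-- Level `≥ 1` iff `#S ≥ 1`. [this work] -/
theorem one_le_lvl_iff : 1 ≤ lvl S ↔ 1 ≤ #S := by unfold lvl; omega
/-- Level `≥ 2` iff `#S ≥ 2`. [this work] -/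
theorem two_le_lvl_iff : 2 ≤ lvl S ↔ 2 ≤ #S := by unfold lvl; omega
/-- Levels are monotone along inclusion. [this work] -/
theorem lvl_mono (hST : S ⊆ T) : lvl S ≤ lvl T := by
  unfold lvl; have := card_le_card hST; omega
end lvllemmas

section statlemmas2
variable {K : Finset (Finset α)} {v : α} {S T : Finset α}

/-- Level of `S ∪ {v}` for `v ∉ S`. [this work] -/
theorem lvl_insert (hv : v ∉ S) : lvl (insert v S) = min (lvl S + 1) 3 := by
  unfold lvl; rw [card_insert_of_notMem hv]; omega

end statlemmas2

/-! ### The 27 + 9 region atoms `α[s,t,L]` and status-rectangle families -/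

/-- The family of sets `S ⊆ V'` with prescribed `X`-status `a`, `Z`-status `b` and level class `L`. [this work] -/
def atomFam (V' : Finset α) (KX KZ : Finset (Finset α)) (v : α) (a b L : ℕ) : Finset (Finset α) :=
  V'.powerset.filter fun S => stat KX v S = a ∧ stat KZ v S = b ∧ lvl S = L

/-- **The region atom** `α[a,b,L] = GF{S ⊆ V' : status (a,b), level L}` (g9 §7.1). [this work] -/
noncomputable def atom (V' : Finset α) (KX KZ : Finset (Finset α)) (v : α) (a b L : ℕ) : MvPolynomial α ℤ :=
  gf (atomFam V' KX KZ v a b L)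

/-- A family cut out of `2^{V'}` by a condition on (X-status, Z-status, level) only. [this work] -/
def statFam (V' : Finset α) (KX KZ : Finset (Finset α)) (v : α) (P : ℕ → ℕ → ℕ → Prop) [∀ a b L, Decidable (P a b L)] :
    Finset (Finset α) :=
  V'.powerset.filter fun S => P (stat KX v S) (stat KZ v S) (lvl S)

/-- Atoms have nonnegative coefficients. [this work] -/
theorem coeff_atom_nonneg (V' : Finset α) (KX KZ : Finset (Finset α)) (v : α) (a b L : ℕ) (n : α →₀ ℕ) :
    0 ≤ (atom V' KX KZ v a b L).coeff n := coeff_gf_nonneg _ n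

omit [DecidableEq α] in
/-- A triple sum with a single matching index collapses. [this work] -/
theorem sum3_ite_eq {β : Type*} [AddCommMonoid β] {a0 b0 L0 : ℕ} (ha : a0 < 3) (hb : b0 < 3) (hL : L0 < 4) (g : ℕ → ℕ → ℕ → β) :
    (∑ a ∈ range 3, ∑ b ∈ range 3, ∑ L ∈ range 4, if a0 = a ∧ b0 = b ∧ L0 = L then g a b L else 0) = g a0 b0 L0 := by
  have h3 : ∀ (a b : ℕ), (∑ L ∈ range 4, if a0 = a ∧ b0 = b ∧ L0 = L then g a b L else 0) =
      if a0 = a ∧ b0 = b then g a b L0 else 0 := by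
    intro a b
    by_cases hab : a0 = a ∧ b0 = b
    · simp only [hab, true_and, if_true]
      rw [sum_ite_eq, if_pos (mem_range.2 hL)]
    · rw [if_neg hab]
      exact sum_eq_zero fun L _ => if_neg fun h => hab ⟨h.1, h.2.1⟩
  simp_rw [h3]
  have h2 : ∀ a : ℕ, (∑ b ∈ range 3, if a0 = a ∧ b0 = b then g a b L0 else 0) = if a0 = a then g a b0 L0 else 0 := by
    intro a
    by_cases ha' : a0 = a
    · simp only [ha', true_and, if_true]
      rw [sum_ite_eq, if_pos (mem_range.2 hb)]
    · rw [if_neg ha']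
      exact sum_eq_zero fun b _ => if_neg fun h => ha' h.1
  simp_rw [h2]
  rw [sum_ite_eq, if_pos (mem_range.2 ha)]

/-- **Every status-rectangle family is a sum of atoms**: `GF(statFam P) = Σ_{a,b,L : P a b L} α[a,b,L]`. [this work] -/
theorem gf_statFam (V' : Finset α) (KX KZ : Finset (Finset α)) (v : α) (P : ℕ → ℕ → ℕ → Prop) [∀ a b L, Decidable (P a b L)] :
    gf (statFam V' KX KZ v P) =
      ∑ a ∈ range 3, ∑ b ∈ range 3, ∑ L ∈ range 4, if P a b L then atom V' KX KZ v a b L else 0 := by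
  -- pointwise decomposition of the indicator of `P(stats S)`
  have hpt : ∀ S : Finset α, (if P (stat KX v S) (stat KZ v S) (lvl S) then (monomial (ind S) (1 : ℤ) : MvPolynomial α ℤ) else 0) =
      ∑ a ∈ range 3, ∑ b ∈ range 3, ∑ L ∈ range 4,
        if stat KX v S = a ∧ stat KZ v S = b ∧ lvl S = L then (if P a b L then monomial (ind S) 1 else 0) else 0 := by
    intro S
    rw [sum3_ite_eq stat_lt_three stat_lt_three lvl_lt_four]
  unfold statFam gf
  rw [sum_filter]
  simp_rw [hpt]
  rw [sum_comm]
  refine sum_congr rfl fun a _ => ?_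
  rw [sum_comm]
  refine sum_congr rfl fun b _ => ?_
  rw [sum_comm]
  refine sum_congr rfl fun L _ => ?_
  by_cases hP : P a b L
  · simp only [hP, if_true]
    unfold atom atomFam gf
    rw [sum_filter]
  · simp only [hP, if_false]
    exact sum_eq_zero fun _ _ => by split_ifs <;> rfl


/-! ### Atom facts: the empty set (level 0), dead vertices, status rectangles are down-sets -/

section atomfacts
variable {V' : Finset α} {KX KZ : Finset (Finset α)} {v : α}

/-- Every member of an atom family lies inside `V'`. [this work] -/
theorem subset_of_mem_atomFam {a b L : ℕ} {S : Finset α} (h : S ∈ atomFam V' KX KZ v a b L) : S ⊆ V' :=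
  mem_powerset.1 (mem_filter.1 h).1

/-- The level-0 atoms: `α[a,b,0] = [statuses of ∅ = (a,b)]`. [this work] -/
theorem atom_zero_eq (a b : ℕ) :
    atom V' KX KZ v a b 0 = if stat KX v ∅ = a ∧ stat KZ v ∅ = b then 1 else 0 := by
  unfold atom atomFam gf
  have hfam : (V'.powerset.filter fun S => stat KX v S = a ∧ stat KZ v S = b ∧ lvl S = 0) =
      if stat KX v ∅ = a ∧ stat KZ v ∅ = b then {∅} else ∅ := by
    ext S
    simp only [mem_filter, mem_powerset, lvl_eq_zero_iff]
    constructor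
    · rintro ⟨_, ha, hb, rfl⟩
      rw [if_pos ⟨ha, hb⟩]; exact mem_singleton_self _
    · intro h
      split_ifs at h with hc
      · rw [mem_singleton] at h; subst h
        exact ⟨empty_subset _, hc.1, hc.2, rfl⟩
      · exact absurd h (notMem_empty _)
  rw [hfam]
  split_ifs
  · rw [sum_singleton]; unfold ind; rw [sum_empty]; rfl
  · rw [sum_empty]

/-- If `v` is dead in the down-set `KX` then all `l`-atoms of `X` vanish. [this work] -/
theorem atom_eq_zero_of_dead_X (hKX : IsLowerSet (KX : Set (Finset α))) (h : {v} ∉ KX) (b L : ℕ) :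
    atom V' KX KZ v 0 b L = 0 := by
  unfold atom atomFam gf
  rw [sum_eq_zero]
  intro S hS
  exact absurd (mem_filter.1 hS).2.1 (stat_ne_zero_of_dead hKX h)

/-- If `v` is dead in the down-set `KZ` then all `l`-atoms of `Z` vanish. [this work] -/
theorem atom_eq_zero_of_dead_Z (hKZ : IsLowerSet (KZ : Set (Finset α))) (h : {v} ∉ KZ) (a L : ℕ) :
    atom V' KX KZ v a 0 L = 0 := by
  unfold atom atomFam gf
  rw [sum_eq_zero]
  intro S hS
  exact absurd (mem_filter.1 hS).2.2.1 (stat_ne_zero_of_dead hKZ h)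

/-- Members of a status family lie inside `V'`. [this work] -/
theorem subset_of_mem_statFam {P : ℕ → ℕ → ℕ → Prop} [∀ a b L, Decidable (P a b L)] {S : Finset α}
    (h : S ∈ statFam V' KX KZ v P) : S ⊆ V' :=
  mem_powerset.1 (mem_filter.1 h).1

/-- A status family with an antitone condition is a down-set (statuses and levels are monotone). [this work] -/
theorem isLowerSet_statFam (hKX : IsLowerSet (KX : Set (Finset α))) (hKZ : IsLowerSet (KZ : Set (Finset α)))
    {P : ℕ → ℕ → ℕ → Prop} [∀ a b L, Decidable (P a b L)]
    (hP : ∀ a b L a' b' L', a' ≤ a → b' ≤ b → L' ≤ L → P a b L → P a' b' L') :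
    IsLowerSet ((statFam V' KX KZ v P : Finset (Finset α)) : Set (Finset α)) := by
  intro T S hST hT
  rw [mem_coe, statFam, mem_filter, mem_powerset] at hT ⊢
  exact ⟨hST.trans hT.1, hP _ _ _ _ _ _ (stat_mono hKX hST) (stat_mono hKZ hST) (lvl_mono hST) hT.2⟩

/-- Intersection of two status families. [this work] -/
theorem statFam_inter (P Q : ℕ → ℕ → ℕ → Prop) [∀ a b L, Decidable (P a b L)] [∀ a b L, Decidable (Q a b L)] :
    statFam V' KX KZ v P ∩ statFam V' KX KZ v Q = statFam V' KX KZ v (fun a b L => P a b L ∧ Q a b L) := by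
  ext S; simp only [statFam, mem_inter, mem_filter]; tauto

/-- Filtering a status family by a level condition. [this work] -/
theorem statFam_filter_card (P : ℕ → ℕ → ℕ → Prop) [∀ a b L, Decidable (P a b L)] (q : ℕ → Prop) [DecidablePred q]
    (Q : ℕ → Prop) [DecidablePred Q] (hq : ∀ S : Finset α, q #S ↔ Q (lvl S)) :
    (statFam V' KX KZ v P).filter (fun S => q #S) = statFam V' KX KZ v (fun a b L => P a b L ∧ Q L) := by
  ext S; simp only [statFam, mem_filter, hq]; tauto

end atomfacts

end Summit.CriticalPhenomena.PercolationContinuityZ3.Theorems.SahiCTCForms
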